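import Mathlib

/-!
# Cluster combinatorics for the bubbling line (B-plan lemmas B8–B9)

Crux workfile for `stmt-ValiantsHypothesis-19979` (`Theses.LacunarySymmetroid.DoorA26`), line
`Cruxes/DoorA26/Lines/wall_bubbling`, obligation (B) `Stmt.stub_bubbling`, plan `Lines/wall_bubbling_B-plan.md`.
Mathlib-only, self-contained; companion of `Lines/wall_bubbling_TwistedRolleExp.lean` (B1–B3).

* `tropical_monotone` (B8) — two zero clusters at distance `L_ν → +∞`, each with its own normalisation of the SAME
  coefficient vector (`H′_ν i = H_ν i · exp (x_ν i · L_ν) · ρ_ν`, `ρ_ν > 0`, all normalised coefficients of modulus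
  `≤ 1`): if the member `m` survives in the left limit and the member `m′` survives in the right limit then
  `x₀ m ≤ x₀ m′`.  (A nonzero class sum has a nonzero member, so this is the member-wise form of
  `max Λ_c ≤ min Λ_{c′}`; class sums are never transferred between clusters.)
* `interval_count` (B9) — nonempty finsets `Λ c ⊆ V` (`c : Fin C`) that are monotonically ordered
  (`c < c′ → ∀ w ∈ Λ c, ∀ w′ ∈ Λ c′, w ≤ w′`) satisfy `∑ c, (|Λ c| − 1) ≤ |V| − 1`.

Nothing here proves `DoorA26`; VP ≠ VNP is not moved.  [folklore]
-/

namespace Summit.ValiantsHypothesis.ValiantsHypothesis.Cruxes.DoorA26.WallBubbling.Clusters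

open Finset Filter Topology

/-! ## B8 — tropical monotonicity (member-wise transfer) -/

/-- **B8.**  Member-wise tropical monotonicity between two clusters at distance `L_ν → +∞`. [folklore] -/
theorem tropical_monotone {ι : Type*} (x H H' : ℕ → ι → ℝ) (x₀ h h' : ι → ℝ) (L ρ : ℕ → ℝ)
    (hx : ∀ i, Tendsto (fun ν => x ν i) atTop (𝓝 (x₀ i)))
    (hH : ∀ i, Tendsto (fun ν => H ν i) atTop (𝓝 (h i)))
    (hH' : ∀ i, Tendsto (fun ν => H' ν i) atTop (𝓝 (h' i)))
    (hbound : ∀ ν i, |H ν i| ≤ 1) (hbound' : ∀ ν i, |H' ν i| ≤ 1)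
    (hρ : ∀ ν, 0 < ρ ν) (hL : Tendsto L atTop atTop)
    (htransfer : ∀ ν i, H' ν i = H ν i * Real.exp (x ν i * L ν) * ρ ν)
    {m m' : ι} (hm : h m ≠ 0) (hm' : h' m' ≠ 0) : x₀ m ≤ x₀ m' := by
  by_contra hlt
  push Not at hlt
  -- positive margins
  set d : ℝ := (x₀ m - x₀ m') / 2 with hd
  have hdpos : 0 < d := by rw [hd]; linarith
  set κ : ℝ := |h m| / 2 with hκ
  set κ' : ℝ := |h' m'| / 2 with hκ'
  have hκpos : 0 < κ := by rw [hκ]; exact half_pos (abs_pos.mpr hm)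
  have hκ'pos : 0 < κ' := by rw [hκ']; exact half_pos (abs_pos.mpr hm')
  -- eventual facts
  have e1 : ∀ᶠ ν in atTop, κ < |H ν m| :=
    ((hH m).abs).eventually_const_lt (by rw [hκ]; linarith [abs_pos.mpr hm])
  have e2 : ∀ᶠ ν in atTop, κ' < |H' ν m'| :=
    ((hH' m').abs).eventually_const_lt (by rw [hκ']; linarith [abs_pos.mpr hm'])
  have e3 : ∀ᶠ ν in atTop, d < x ν m - x ν m' :=
    ((hx m).sub (hx m')).eventually_const_lt (by rw [hd]; linarith)
  have e4 : ∀ᶠ ν in atTop, 0 ≤ L ν := hL.eventually_ge_atTop 0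
  have e5 : ∀ᶠ ν in atTop, 1 / (κ * κ') < Real.exp (d * L ν) :=
    (Real.tendsto_exp_atTop.comp (Filter.Tendsto.const_mul_atTop hdpos hL)).eventually_gt_atTop _
  have hfalse : ∀ᶠ ν : ℕ in atTop, False := by
    filter_upwards [e1, e2, e3, e4, e5] with ν h1 h2 h3 h4 h5
    set E : ℝ := Real.exp (x ν m * L ν) with hE
    set E' : ℝ := Real.exp (x ν m' * L ν) with hE'
    have hEpos : 0 < E := Real.exp_pos _
    have hE'pos : 0 < E' := Real.exp_pos _
    have hρν := hρ ν
    -- |H' m| = |H m| E ρ ≤ 1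
    have hb1 : |H ν m| * (E * ρ ν) ≤ 1 := by
      have := hbound' ν m
      rw [htransfer ν m, abs_mul, abs_mul, abs_of_pos hEpos, abs_of_pos hρν] at this
      linarith [this]
    -- κ' < |H' m'| = |H m'| E' ρ ≤ E' ρ
    have hb2 : κ' < E' * ρ ν := by
      have h2' := h2
      rw [htransfer ν m', abs_mul, abs_mul, abs_of_pos hE'pos, abs_of_pos hρν] at h2'
      have : |H ν m'| * E' * ρ ν ≤ 1 * E' * ρ ν := by
        apply mul_le_mul_of_nonneg_right _ hρν.le
        exact mul_le_mul_of_nonneg_right (hbound ν m') hE'pos.le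
      linarith
    -- exp (d L) E' ≤ E
    have hb3 : Real.exp (d * L ν) * E' ≤ E := by
      rw [hE, hE', ← Real.exp_add]
      apply Real.exp_le_exp.mpr
      nlinarith [mul_nonneg (sub_nonneg.mpr h3.le) h4]
    -- chain
    have hchain : κ * (Real.exp (d * L ν) * κ') ≤ 1 := by
      calc κ * (Real.exp (d * L ν) * κ')
          ≤ κ * (Real.exp (d * L ν) * (E' * ρ ν)) := by
            apply mul_le_mul_of_nonneg_left _ hκpos.le
            exact mul_le_mul_of_nonneg_left hb2.le (Real.exp_pos _).le
        _ = κ * ((Real.exp (d * L ν) * E') * ρ ν) := by ring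
        _ ≤ κ * (E * ρ ν) := by
            apply mul_le_mul_of_nonneg_left _ hκpos.le
            exact mul_le_mul_of_nonneg_right hb3 hρν.le
        _ ≤ |H ν m| * (E * ρ ν) := by
            exact mul_le_mul_of_nonneg_right h1.le (mul_pos hEpos hρν).le
        _ ≤ 1 := hb1
    have h5' : 1 < Real.exp (d * L ν) * (κ * κ') := (div_lt_iff₀ (mul_pos hκpos hκ'pos)).mp h5
    nlinarith [hchain, h5']
  exact hfalse.exists.elim fun _ h => h

/-- A nonzero class sum has a nonzero member (the bridge from the class form of B3 to the member form of B8).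
[folklore] -/
theorem exists_member_of_classSum_ne_zero {ι : Type*} [Fintype ι] (a x : ι → ℝ) (w : ℝ)
    (h : (∑ i, if x i = w then a i else 0) ≠ 0) : ∃ i, x i = w ∧ a i ≠ 0 := by
  obtain ⟨i, _, hi⟩ := Finset.exists_ne_zero_of_sum_ne_zero h
  by_cases hx : x i = w
  · rw [if_pos hx] at hi
    exact ⟨i, hx, hi⟩
  · rw [if_neg hx] at hi
    exact absurd rfl hi

/-! ## B9 — the interval count -/

/-- **B9.**  Monotonically ordered nonempty finsets inside `V` satisfy `∑ c, (|Λ c| − 1) ≤ |V| − 1`. [folklore] -/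
theorem interval_count (V : Finset ℝ) {C : ℕ} (Λ : Fin C → Finset ℝ) (hne : ∀ c, (Λ c).Nonempty)
    (hsub : ∀ c, Λ c ⊆ V) (hmono : ∀ c c', c < c' → ∀ w ∈ Λ c, ∀ w' ∈ Λ c', w ≤ w') :
    ∑ c, ((Λ c).card - 1) ≤ V.card - 1 := by
  classical
  cases C with
  | zero => simp
  | succ C' =>
    set A : Fin (C' + 1) → Finset ℝ := fun c => (Λ c).erase ((Λ c).max' (hne c)) with hA
    have hAcard : ∀ c, (A c).card = (Λ c).card - 1 := fun c =>
      Finset.card_erase_of_mem (Finset.max'_mem _ _)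
    -- members of `A c` lie strictly below `max' (Λ c)`
    have hAlt : ∀ c, ∀ w ∈ A c, w < (Λ c).max' (hne c) := by
      intro c w hw
      obtain ⟨hne', hmem⟩ := Finset.mem_erase.mp hw
      exact lt_of_le_of_ne (Finset.le_max' _ _ hmem) hne'
    have hAsub : ∀ c, ∀ w ∈ A c, w ∈ Λ c := fun c w hw => (Finset.mem_erase.mp hw).2
    -- pairwise disjoint
    have hdisj : ∀ c c', c < c' → Disjoint (A c) (A c') := by
      intro c c' hcc'
      rw [Finset.disjoint_left]
      intro w hw hw'
      have h1 : w < (Λ c).max' (hne c) := hAlt c w hw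
      have h2 : (Λ c).max' (hne c) ≤ w := hmono c c' hcc' _ (Finset.max'_mem _ _) w (hAsub c' w hw')
      linarith
    have hpd : (↑(Finset.univ : Finset (Fin (C' + 1))) : Set (Fin (C' + 1))).PairwiseDisjoint A := by
      intro c _ c' _ hcc'
      change Disjoint (A c) (A c')
      rcases lt_or_gt_of_ne hcc' with hlt | hgt
      · exact hdisj c c' hlt
      · exact (hdisj c' c hgt).symm
    -- the union misses the last maximum
    set top : ℝ := (Λ (Fin.last C')).max' (hne _) with htop
    have htopV : top ∈ V := hsub _ (Finset.max'_mem _ _)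
    have hUsub : Finset.univ.biUnion A ⊆ V.erase top := by
      intro w hw
      obtain ⟨c, _, hwc⟩ := Finset.mem_biUnion.mp hw
      refine Finset.mem_erase.mpr ⟨?_, hsub c (hAsub c w hwc)⟩
      have hwlt : w < (Λ c).max' (hne c) := hAlt c w hwc
      rcases (Fin.le_last c).lt_or_eq with hlt | heq
      · have : (Λ c).max' (hne c) ≤ top :=
          hmono c (Fin.last C') hlt _ (Finset.max'_mem _ _) _ (Finset.max'_mem _ _)
        exact ne_of_lt (lt_of_lt_of_le hwlt this)
      · subst heq
        exact ne_of_lt hwlt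
    calc ∑ c, ((Λ c).card - 1) = ∑ c, (A c).card := by simp_rw [hAcard]
      _ = (Finset.univ.biUnion A).card := (Finset.card_biUnion hpd).symm
      _ ≤ (V.erase top).card := Finset.card_le_card hUsub
      _ = V.card - 1 := Finset.card_erase_of_mem htopV

end Summit.ValiantsHypothesis.ValiantsHypothesis.Cruxes.DoorA26.WallBubbling.Clusters
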